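import Summits.Ventures.PercRepro.ProfilePointedSeries

/-!
# PercRepro — THE COLOOP LIMIT ACROSS A SEPARATOR: `Φ(M, p) = #BI(A) · Φ_B(p)`
(p10, gen 17; `proofs/P10-AVFULL.md` §25(f)(ii))

Let `E = A ⊔ B` be a separation of the finite matroid `M` (`rk A + rk B = rk E`) with the point `p ∈ B`.  The rank is
additive across the separator (`rk_eq_rk_inter_add_rk_sdiff_of_separator`, two applications of submodularity), so a
set is independent iff both its parts are, and `p ∈ cl X` iff `p ∈ cl (X ∖ A)`.  Hence the captured family splits as a
product, `𝒦(M, p) ≅ BI(A) × 𝒦_B(p)` (`X ↦ (X ∩ A, X ∖ A)`), where `BI(A)` is the family of bi-independent subsets of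
`A` (`biIndepIn`) and `𝒦_B(p)` the captured `p`-avoiding bi-independent subsets of `B` (`capIn`); the signed size
splits as `(2 #(X ∩ A) − #A) + (2 #(X ∖ A) − #B)`, and the `A`-part sums to `0` by the complement involution of
`BI(A)` (`sum_biIndepIn_signed`).  THE THEOREM (`sum_capSets_signed_separator`):

  `Σ_{X ∈ 𝒦(M,p)} (2 #X − N)  =  #BI(A) · Σ_{X₂ ∈ 𝒦_B(p)} (2 #X₂ − #B)`,

so (C1′) at `(M, p)` follows from its `B`-part (`capLimit_body_of_separator_of_nonneg`): loops kill `𝒦`, coloops double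
`Φ`, and (C1′) reduces to the connected component of `p` (the `B`-part is `Φ(M|B, p)` — stated here inside `M`, without
the restriction).  Nothing here asserts (C1′) in general.
-/

open scoped Matroid

namespace PercRepro.Cogirth

open Finset ThmH Skew

variable {α : Type} [DecidableEq α] {M : Matroid α} [M.Finite]

/-! ### Submodularity and additivity across a separator -/

/-- Submodularity of the rank, Finset form. -/
theorem rk_inter_add_rk_union_le_sep (X Y : Finset α) : rk M (X ∩ Y) + rk M (X ∪ Y) ≤ rk M X + rk M Y := by
  have h := M.eRk_inter_add_eRk_union_le (X : Set α) (Y : Set α)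
  rw [← coe_inter, ← coe_union, ← coe_rk, ← coe_rk, ← coe_rk, ← coe_rk] at h
  exact_mod_cast h

/-- `(X ∩ A) ∪ (X ∖ A) = X`. -/
theorem inter_union_sdiff_eq_self (X A : Finset α) : (X ∩ A) ∪ (X \ A) = X := by
  ext z
  simp only [mem_union, mem_inter, mem_sdiff]
  tauto

/-- `(X ∩ A) ∩ (X ∖ A) = ∅`. -/
theorem inter_inter_sdiff_eq_empty (X A : Finset α) : (X ∩ A) ∩ (X \ A) = ∅ := by
  ext z
  simp only [mem_inter, mem_sdiff, notMem_empty, iff_false, not_and, and_imp]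
  intro _ hzA _ hzA'
  exact hzA' hzA

/-- `rk X ≤ rk (X ∩ A) + rk (X ∖ A)` (submodularity on the two parts). -/
theorem rk_le_rk_inter_add_rk_sdiff (X A : Finset α) : rk M X ≤ rk M (X ∩ A) + rk M (X \ A) := by
  have h := rk_inter_add_rk_union_le_sep (M := M) (X ∩ A) (X \ A)
  rw [inter_inter_sdiff_eq_empty, inter_union_sdiff_eq_self] at h
  have h0 : rk M (∅ : Finset α) = 0 := by
    have := rk_le_card (M := M) ∅
    rw [card_empty] at this
    omega
  omega

/-- **ADDITIVITY ACROSS A SEPARATOR**: if `rk A + rk (E ∖ A) = rk E` then `rk X = rk (X ∩ A) + rk (X ∖ A)` for every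
`X ⊆ E`. -/
theorem rk_eq_rk_inter_add_rk_sdiff_of_separator {A : Finset α} (hA : A ⊆ gr M)
    (hsep : rk M A + rk M (gr M \ A) = rk M (gr M)) {X : Finset α} (hX : X ⊆ gr M) :
    rk M X = rk M (X ∩ A) + rk M (X \ A) := by
  apply le_antisymm (rk_le_rk_inter_add_rk_sdiff X A)
  -- submodularity on `X ∪ (E ∖ A)` and `A`, and on `X` and `E ∖ A`
  have h1 := rk_inter_add_rk_union_le_sep (M := M) (X ∪ (gr M \ A)) A
  have h2 := rk_inter_add_rk_union_le_sep (M := M) X (gr M \ A)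
  have e1 : (X ∪ (gr M \ A)) ∩ A = X ∩ A := by
    ext z
    simp only [mem_inter, mem_union, mem_sdiff]
    tauto
  have e2 : X ∪ (gr M \ A) ∪ A = gr M := by
    ext z
    simp only [mem_union, mem_sdiff]
    constructor
    · rintro ((hz | ⟨hz, -⟩) | hz)
      · exact hX hz
      · exact hz
      · exact hA hz
    · intro hz
      by_cases hzA : z ∈ A
      · exact Or.inr hzA
      · exact Or.inl (Or.inr ⟨hz, hzA⟩)
  have e3 : X ∩ (gr M \ A) = X \ A := by
    ext z
    simp only [mem_inter, mem_sdiff]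
    constructor
    · rintro ⟨hz, -, hzA⟩
      exact ⟨hz, hzA⟩
    · rintro ⟨hz, hzA⟩
      exact ⟨hz, hX hz, hzA⟩
  rw [e1, e2] at h1
  rw [e3] at h2
  omega

/-- Across a separator, a set is independent iff both its parts are. -/
theorem rk_eq_card_iff_parts_of_separator {A : Finset α} (hA : A ⊆ gr M)
    (hsep : rk M A + rk M (gr M \ A) = rk M (gr M)) {X : Finset α} (hX : X ⊆ gr M) :
    rk M X = X.card ↔ rk M (X ∩ A) = (X ∩ A).card ∧ rk M (X \ A) = (X \ A).card := by
  have hadd := rk_eq_rk_inter_add_rk_sdiff_of_separator hA hsep hX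
  have hc : (X ∩ A).card + (X \ A).card = X.card := card_inter_add_card_sdiff X A
  have h1 := rk_le_card (M := M) (X ∩ A)
  have h2 := rk_le_card (M := M) (X \ A)
  constructor
  · intro h
    constructor <;> omega
  · rintro ⟨h3, h4⟩
    omega

/-- Across a separator, a point of `B = E ∖ A` is spanned by `X` iff it is spanned by the `B`-part of `X`. -/
theorem mem_clF_iff_mem_clF_sdiff_of_separator {A : Finset α} (hA : A ⊆ gr M)
    (hsep : rk M A + rk M (gr M \ A) = rk M (gr M)) {p : α} (hp : p ∈ gr M) (hpA : p ∉ A)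
    {X : Finset α} (hX : X ⊆ gr M) : p ∈ clF M X ↔ p ∈ clF M (X \ A) := by
  rw [mem_clF_iff_rk_insert_eq hp hX, mem_clF_iff_rk_insert_eq hp (sdiff_subset.trans hX)]
  have h1 := rk_eq_rk_inter_add_rk_sdiff_of_separator hA hsep (insert_subset hp hX)
  have h2 := rk_eq_rk_inter_add_rk_sdiff_of_separator hA hsep hX
  have e1 : insert p X ∩ A = X ∩ A := by
    ext z
    simp only [mem_inter, mem_insert]
    constructor
    · rintro ⟨hz | hz, hzA⟩
      · exact absurd (hz ▸ hzA) hpA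
      · exact ⟨hz, hzA⟩
    · rintro ⟨hz, hzA⟩
      exact ⟨Or.inr hz, hzA⟩
  have e2 : insert p X \ A = insert p (X \ A) := by
    rw [insert_sdiff_of_notMem _ hpA]
  rw [e1, e2] at h1
  omega

/-! ### The two factors -/

/-- `BI(A)`: the bi-independent subsets of `A`, inside `M`. -/
noncomputable def biIndepIn (M : Matroid α) [M.Finite] (A : Finset α) : Finset (Finset α) :=
  A.powerset.filter (fun X => rk M X = X.card ∧ rk M (A \ X) = (A \ X).card)

/-- Membership in `BI(A)`. -/
theorem mem_biIndepIn {A X : Finset α} :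
    X ∈ biIndepIn M A ↔ X ⊆ A ∧ rk M X = X.card ∧ rk M (A \ X) = (A \ X).card := by
  unfold biIndepIn
  rw [mem_filter, mem_powerset]

/-- The complement involution of `BI(A)` kills the signed size: `Σ_{X ∈ BI(A)} (2 #X − #A) = 0`. -/
theorem sum_biIndepIn_signed (A : Finset α) :
    ∑ X ∈ biIndepIn M A, (2 * (X.card : ℤ) - A.card) = 0 := by
  apply sum_involution (fun X _ => A \ X)
  · intro X hX
    have hXA : X ⊆ A := (mem_biIndepIn.1 hX).1
    have h : (A \ X).card + X.card = A.card := by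
      rw [card_sdiff_of_subset hXA]
      have := card_le_card hXA
      omega
    have h' : ((A \ X).card : ℤ) + X.card = A.card := by exact_mod_cast h
    linarith
  · intro X hX hne heq
    have hXA : X ⊆ A := (mem_biIndepIn.1 hX).1
    have h : (A \ X).card + X.card = A.card := by
      rw [card_sdiff_of_subset hXA]
      have := card_le_card hXA
      omega
    rw [heq] at h
    apply hne
    have h' : (X.card : ℤ) + X.card = A.card := by exact_mod_cast h
    linarith
  · intro X hX
    rw [mem_biIndepIn] at hX ⊢
    obtain ⟨hXA, h1, h2⟩ := hX
    refine ⟨sdiff_subset, h2, ?_⟩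
    rw [Finset.sdiff_sdiff_eq_self hXA]
    exact h1
  · intro X hX
    exact Finset.sdiff_sdiff_eq_self (mem_biIndepIn.1 hX).1

/-- `𝒦_B(p)`: the captured `p`-avoiding bi-independent subsets of `B`, inside `M`. -/
noncomputable def capIn (M : Matroid α) [M.Finite] (B : Finset α) (p : α) : Finset (Finset α) :=
  (B.erase p).powerset.filter (fun X => rk M X = X.card ∧ rk M (B \ X) = (B \ X).card ∧ p ∈ clF M X)

/-- Membership in `𝒦_B(p)`. -/
theorem mem_capIn {B X : Finset α} {p : α} :
    X ∈ capIn M B p ↔ X ⊆ B.erase p ∧ rk M X = X.card ∧ rk M (B \ X) = (B \ X).card ∧ p ∈ clF M X := by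
  unfold capIn
  rw [mem_filter, mem_powerset]

/-! ### The product decomposition -/

/-- **THE CAPTURED FAMILY SPLITS ACROSS A SEPARATOR**: `X ↦ (X ∩ A, X ∖ A)` is a bijection from `𝒦(M, p)` onto
`BI(A) × 𝒦_B(p)` (`B = E ∖ A ∋ p`), and the signed size is additive. -/
theorem sum_capSets_signed_separator {A : Finset α} {p : α} (hp : p ∈ gr M) (hA : A ⊆ gr M) (hpA : p ∉ A)
    (hsep : rk M A + rk M (gr M \ A) = rk M (gr M)) :
    ∑ X ∈ capSets M p, (2 * (X.card : ℤ) - (gr M).card) =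
      (biIndepIn M A).card * ∑ X₂ ∈ capIn M (gr M \ A) p, (2 * (X₂.card : ℤ) - (gr M \ A).card) := by
  have hcard : A.card + (gr M \ A).card = (gr M).card := by
    rw [card_sdiff_of_subset hA]
    have := card_le_card hA
    omega
  have hsplit : ∑ X ∈ capSets M p, (2 * (X.card : ℤ) - (gr M).card) =
      ∑ q ∈ biIndepIn M A ×ˢ capIn M (gr M \ A) p,
        ((2 * (q.1.card : ℤ) - A.card) + (2 * (q.2.card : ℤ) - (gr M \ A).card)) := by
    apply sum_nbij' (fun X => (X ∩ A, X \ A)) (fun q => q.1 ∪ q.2)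
    · intro X hX
      obtain ⟨⟨hXb, hpX⟩, hpcl⟩ := mem_capSets.1 hX
      obtain ⟨hXg, hXr, hXc⟩ := mem_biIndepAll.1 hXb
      have hparts := (rk_eq_card_iff_parts_of_separator hA hsep hXg).1 hXr
      have hZg : gr M \ X ⊆ gr M := sdiff_subset
      have hcparts := (rk_eq_card_iff_parts_of_separator hA hsep hZg).1 hXc
      have e1 : (gr M \ X) ∩ A = A \ (X ∩ A) := by
        ext z
        simp only [mem_inter, mem_sdiff, not_and]
        constructor
        · rintro ⟨⟨hz, hzX⟩, hzA⟩
          exact ⟨hzA, fun hzX' => absurd hzX' hzX⟩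
        · rintro ⟨hzA, h⟩
          exact ⟨⟨hA hzA, fun hzX => h hzX hzA⟩, hzA⟩
      have e2 : (gr M \ X) \ A = (gr M \ A) \ (X \ A) := by
        ext z
        simp only [mem_sdiff, not_and, not_not]
        constructor
        · rintro ⟨⟨hz, hzX⟩, hzA⟩
          exact ⟨⟨hz, hzA⟩, fun hzX' => absurd hzX' hzX⟩
        · rintro ⟨⟨hz, hzA⟩, h⟩
          exact ⟨⟨hz, fun hzX => hzA (h hzX)⟩, hzA⟩
      rw [e1] at hcparts
      rw [e2] at hcparts
      rw [mem_product, mem_biIndepIn, mem_capIn]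
      refine ⟨⟨inter_subset_right, hparts.1, hcparts.1⟩, ?_, hparts.2, hcparts.2,
        (mem_clF_iff_mem_clF_sdiff_of_separator hA hsep hp hpA hXg).1 hpcl⟩
      intro z hz
      rw [mem_sdiff] at hz
      rw [mem_erase, mem_sdiff]
      exact ⟨fun h => hpX (h ▸ hz.1), hXg hz.1, hz.2⟩
    · intro q hq
      rw [mem_product, mem_biIndepIn, mem_capIn] at hq
      obtain ⟨⟨h1A, h1r, h1c⟩, h2B, h2r, h2c, h2cl⟩ := hq
      have h2B' : q.2 ⊆ gr M \ A := h2B.trans (erase_subset _ _)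
      have hdisj : q.1 ∩ q.2 = ∅ := by
        ext z
        simp only [mem_inter, notMem_empty, iff_false, not_and]
        intro hz1 hz2
        exact (mem_sdiff.1 (h2B' hz2)).2 (h1A hz1)
      have hUg : q.1 ∪ q.2 ⊆ gr M := union_subset (h1A.trans hA) (h2B'.trans sdiff_subset)
      have eA : (q.1 ∪ q.2) ∩ A = q.1 := by
        ext z
        simp only [mem_inter, mem_union]
        constructor
        · rintro ⟨hz | hz, hzA⟩
          · exact hz
          · exact absurd hzA (mem_sdiff.1 (h2B' hz)).2
        · intro hz
          exact ⟨Or.inl hz, h1A hz⟩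
      have eB : (q.1 ∪ q.2) \ A = q.2 := by
        ext z
        simp only [mem_sdiff, mem_union]
        constructor
        · rintro ⟨hz | hz, hzA⟩
          · exact absurd (h1A hz) hzA
          · exact hz
        · intro hz
          exact ⟨Or.inr hz, (mem_sdiff.1 (h2B' hz)).2⟩
      have eAc : (gr M \ (q.1 ∪ q.2)) ∩ A = A \ q.1 := by
        ext z
        simp only [mem_inter, mem_sdiff, mem_union, not_or]
        constructor
        · rintro ⟨⟨-, hz1, -⟩, hzA⟩
          exact ⟨hzA, hz1⟩
        · rintro ⟨hzA, hz1⟩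
          exact ⟨⟨hA hzA, hz1, fun hz2 => (mem_sdiff.1 (h2B' hz2)).2 hzA⟩, hzA⟩
      have eBc : (gr M \ (q.1 ∪ q.2)) \ A = (gr M \ A) \ q.2 := by
        ext z
        simp only [mem_sdiff, mem_union, not_or]
        constructor
        · rintro ⟨⟨hz, -, hz2⟩, hzA⟩
          exact ⟨⟨hz, hzA⟩, hz2⟩
        · rintro ⟨⟨hz, hzA⟩, hz2⟩
          exact ⟨⟨hz, fun hz1 => hzA (h1A hz1), hz2⟩, hzA⟩
      have hpU : p ∉ q.1 ∪ q.2 := by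
        rw [mem_union, not_or]
        exact ⟨fun h => hpA (h1A h), fun h => (mem_erase.1 (h2B h)).1 rfl⟩
      rw [mem_capSets, mem_biIndepAll]
      refine ⟨⟨⟨hUg, ?_, ?_⟩, hpU⟩, ?_⟩
      · rw [rk_eq_card_iff_parts_of_separator hA hsep hUg, eA, eB]
        exact ⟨h1r, h2r⟩
      · rw [rk_eq_card_iff_parts_of_separator hA hsep sdiff_subset, eAc, eBc]
        exact ⟨h1c, h2c⟩
      · rw [mem_clF_iff_mem_clF_sdiff_of_separator hA hsep hp hpA hUg, eB]
        exact h2cl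
    · intro X _
      exact inter_union_sdiff_eq_self X A
    · intro q hq
      rw [mem_product, mem_biIndepIn, mem_capIn] at hq
      obtain ⟨⟨h1A, -, -⟩, h2B, -, -, -⟩ := hq
      have h2B' : q.2 ⊆ gr M \ A := h2B.trans (erase_subset _ _)
      have eA : (q.1 ∪ q.2) ∩ A = q.1 := by
        ext z
        simp only [mem_inter, mem_union]
        constructor
        · rintro ⟨hz | hz, hzA⟩
          · exact hz
          · exact absurd hzA (mem_sdiff.1 (h2B' hz)).2
        · intro hz
          exact ⟨Or.inl hz, h1A hz⟩
      have eB : (q.1 ∪ q.2) \ A = q.2 := by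
        ext z
        simp only [mem_sdiff, mem_union]
        constructor
        · rintro ⟨hz | hz, hzA⟩
          · exact absurd (h1A hz) hzA
          · exact hz
        · intro hz
          exact ⟨Or.inr hz, (mem_sdiff.1 (h2B' hz)).2⟩
      rw [eA, eB]
    · intro X _
      have hc : (X ∩ A).card + (X \ A).card = X.card := card_inter_add_card_sdiff X A
      have hc' : ((X ∩ A).card : ℤ) + (X \ A).card = X.card := by exact_mod_cast hc
      have hcard' : (A.card : ℤ) + (gr M \ A).card = (gr M).card := by exact_mod_cast hcard
      linarith
  rw [hsplit, sum_product]
  have e : ∀ X₁ ∈ biIndepIn M A,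
      ∑ X₂ ∈ capIn M (gr M \ A) p,
        ((2 * (((X₁, X₂) : Finset α × Finset α).1.card : ℤ) - A.card) +
          (2 * (((X₁, X₂) : Finset α × Finset α).2.card : ℤ) - (gr M \ A).card)) =
      (capIn M (gr M \ A) p).card * (2 * (X₁.card : ℤ) - A.card) +
        ∑ X₂ ∈ capIn M (gr M \ A) p, (2 * (X₂.card : ℤ) - (gr M \ A).card) := by
    intro X₁ _
    dsimp only
    rw [sum_add_distrib, sum_const, nsmul_eq_mul]
  rw [sum_congr rfl e, sum_add_distrib, ← mul_sum, sum_biIndepIn_signed, mul_zero, zero_add, sum_const,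
    nsmul_eq_mul]

/-- **(C1′) ACROSS A SEPARATOR**: if the `B`-part of the coloop limit is non-negative, (C1′) holds at `(M, p)`. -/
theorem capLimit_body_of_separator_of_nonneg {A : Finset α} {p : α} (hp : p ∈ gr M) (hA : A ⊆ gr M) (hpA : p ∉ A)
    (hsep : rk M A + rk M (gr M \ A) = rk M (gr M))
    (h : 0 ≤ ∑ X₂ ∈ capIn M (gr M \ A) p, (2 * (X₂.card : ℤ) - (gr M \ A).card)) :
    (gr M).card * ∑ k ∈ range ((gr M).card + 1), capCount M k p ≤
      2 * ∑ k ∈ range ((gr M).card + 1), k * capCount M k p := by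
  rw [capLimit_body_iff_sum_nonneg, sum_capSets_signed_separator hp hA hpA hsep]
  have : (0 : ℤ) ≤ (biIndepIn M A).card := by exact_mod_cast Nat.zero_le _
  exact mul_nonneg this h

end PercRepro.Cogirth
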